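import Mathlib
import Summits.MatrixMultiplication.MatrixMultiplication.Theses.BrentRefutationDepth

/-!
# Brent systems have no Nullstellensatz refutation in multiplier degree `≤ 5`

Route `BrentRefutationDepth` of `MatrixMultiplication`, support item `NoLinearDepthRefutation`
(stmt-MatrixMultiplication-5587): for `r ≥ 3` (the proof below only uses `r ≥ 2`) and every `n`,
the Brent system `B(n,r)` — the equations `∑_{t<r} a_{t,i} b_{t,j} c_{t,k} = ⟨n,n,n⟩_{ijk}` in
the `3rn²` unknowns `X (0,t,i) = a_{t,i}`, `X (1,t,j) = b_{t,j}`, `X (2,t,k) = c_{t,k}` — has no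
Nullstellensatz refutation `∑ g_{ijk} · B_{ijk} = 1` with multipliers `g_{ijk}` of total degree
`≤ 5`.  Hence the refutation depth `D_NS(n,r)` is at least `6` (first rung of the route's depth
ladder).

## Proof (coefficient extraction; valid for an arbitrary right-hand side `T` and any field of
characteristic `0`)

Write `m_t(e) = a_{t,e₁} b_{t,e₂} c_{t,e₃}` (`e = (e₁,e₂,e₃)`), `B_e = ∑_t m_t(e) - T_e`,
`c_e = coeff_1 g_e` and `λ_{e,t,f} = coeff_{m_t(f)} g_e`.  Comparing coefficients in
`∑_e g_e B_e = 1`: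
* at the monomial `1`: `-∑_e c_e T_e = 1`;
* at `m_s(e)`: `c_e = ∑_{e'} λ_{e',s,e} T_{e'}` (a triad monomial `m_{s'}(e')` divides `m_s(e)`
  only if it equals it);
* at `m_t(f) · m_s(e)` with `t ≠ s` — a monomial of degree `6`, invisible in the `g_e` of degree
  `≤ 5`; the triad monomials dividing it are exactly `m_t(f)` and `m_s(e)` —:
  `λ_{f,s,e} + λ_{e,t,f} = 0`.
For two distinct slots `s₀ ≠ s₁` the second relation writes `S = ∑_e c_e T_e` both as
`∑_{e,e'} λ_{e',s₀,e} T_{e'} T_e` and as `∑_{e,e'} λ_{e,s₁,e'} T_e T_{e'}`, and the third makes these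
two double sums negatives of each other; so `S = -S`, `S = 0`, contradicting `S = -1`.

No torus-weight projection is needed.  The argument is the "hand proof" recorded in the route
file (Brent 1975 equations; de Groote 1978 for the symmetry heuristics behind it).

## Design

To keep this a pure proof file (no definition, no notation), the exponent vector
`D t e = single (0,t,e₁) 1 + single (1,t,e₂) 1 + single (2,t,e₃) 1` of the triad monomial
`m_t(e)` is a section variable `D` constrained by the hypothesis `hD`; the final corollary
instantiates it.
-/

-- `Summit.<Summit>.<Problem>` is the tree's mandated summit-side namespace; for this
-- single-conjunct summit the two coincide, so the file silences `dupNamespace`.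
set_option linter.dupNamespace false
set_option autoImplicit false

namespace Summit.MatrixMultiplication.MatrixMultiplication.Theorems

open MvPolynomial

/-! ## Two indicator inequalities in `ℕ` -/

/-- `1 ≤ [c] ↔ c` for an indicator in `ℕ`. -/
private theorem one_le_ite_iff {c : Prop} [Decidable c] :
    (1 : ℕ) ≤ (if c then 1 else 0) ↔ c := by
  split_ifs with h <;> simp [h]

/-- `1 ≤ [c] + [d] ↔ c ∨ d` for indicators in `ℕ`. -/
private theorem one_le_ite_add_ite_iff {c d : Prop} [Decidable c] [Decidable d] :
    (1 : ℕ) ≤ (if c then 1 else 0) + (if d then 1 else 0) ↔ c ∨ d := by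
  by_cases h : c <;> by_cases h' : d <;> simp [h, h']

/-! ## Coefficients of a Nullstellensatz combination -/

section Coeff

variable {E τ σ K : Type*} [Fintype E] [Fintype τ] [CommRing K]

/-- Coefficients of a Nullstellensatz combination `∑_e g_e · (∑_t X^{D t e} - T_e)`:
the coefficient at `m` collects `coeff_{m - D t e} g_e` over the monic monomials `X^{D t e}`
dividing `X^m`, minus `T_e · coeff_m g_e`. -/
theorem coeff_sum_mul_brent (D : τ → E → σ →₀ ℕ) (T : E → K) (g : E → MvPolynomial σ K)
    (m : σ →₀ ℕ) :
    coeff m (∑ e, g e * ((∑ t, monomial (D t e) 1) - C (T e))) =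
      ∑ e, ((∑ t, if D t e ≤ m then coeff (m - D t e) (g e) else 0) - coeff m (g e) * T e) := by
  have hC : ∀ e, g e * C (T e) = C (T e) * g e := fun e => mul_comm _ _
  simp only [mul_sub, Finset.mul_sum, hC, coeff_sum, coeff_sub, coeff_mul_monomial', mul_one,
    coeff_C_mul, mul_comm (T _)]

end Coeff

/-! ## Triad exponent vectors -/

section TriadExp

variable {ι τ : Type*} {D : τ → ι × ι × ι → (Fin 3 × τ × ι) →₀ ℕ}
  (hD : ∀ t e, D t e = Finsupp.single ((0 : Fin 3), t, e.1) 1 +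
    Finsupp.single ((1 : Fin 3), t, e.2.1) 1 + Finsupp.single ((2 : Fin 3), t, e.2.2) 1)
include hD

/-- The triad monomial `X (0,t,i) * X (1,t,j) * X (2,t,k)` is the monic monomial with exponent
`D t (i,j,k)`. -/
theorem X_mul_X_mul_X_eq_monomial {R : Type*} [CommSemiring R] (t : τ) (i j k : ι) :
    (X ((0 : Fin 3), t, i) * X ((1 : Fin 3), t, j) * X ((2 : Fin 3), t, k) :
      MvPolynomial (Fin 3 × τ × ι) R) = monomial (D t (i, j, k)) 1 := by
  simp [hD, X, monomial_mul]

/-- A triad exponent vector has degree `3`. -/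
theorem degree_triadExp (t : τ) (e : ι × ι × ι) : (D t e).degree = 3 := by
  simp [hD, map_add]

/-- A triad exponent vector is nonzero. -/
theorem triadExp_ne_zero (t : τ) (e : ι × ι × ι) : D t e ≠ 0 := by
  intro h
  have h3 := degree_triadExp hD t e
  rw [h, map_zero] at h3
  exact absurd h3 (by norm_num)

/-- The coefficient of a degree-`6` monomial `m_t(f) · m_s(e)` in a polynomial of total degree
`≤ 5` vanishes. -/
theorem coeff_triadExp_add_triadExp {R : Type*} [CommSemiring R] (t s : τ) (f e : ι × ι × ι)
    {p : MvPolynomial (Fin 3 × τ × ι) R} (hp : p.totalDegree ≤ 5) :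
    coeff (D t f + D s e) p = 0 := by
  apply coeff_eq_zero_of_totalDegree_lt
  rw [← Finsupp.degree_apply, map_add, degree_triadExp hD, degree_triadExp hD]
  omega

/-- A triad exponent vector is not `≤ 0`. -/
theorem ite_triadExp_le_zero {M : Type*} [Zero M] (t : τ) (e : ι × ι × ι) (x : M) :
    (if D t e ≤ 0 then x else 0) = 0 :=
  if_neg fun h => triadExp_ne_zero hD t e (nonpos_iff_eq_zero.1 h)

variable [DecidableEq τ] [DecidableEq ι]

/-- Value of a triad exponent vector at an `a`-variable. -/
theorem triadExp_apply_zero (t s : τ) (e : ι × ι × ι) (i : ι) :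
    D t e (0, s, i) = if t = s ∧ e.1 = i then 1 else 0 := by
  simp [hD, Finsupp.single_apply]

/-- Value of a triad exponent vector at a `b`-variable. -/
theorem triadExp_apply_one (t s : τ) (e : ι × ι × ι) (j : ι) :
    D t e (1, s, j) = if t = s ∧ e.2.1 = j then 1 else 0 := by
  simp [hD, Finsupp.single_apply]

/-- Value of a triad exponent vector at a `c`-variable. -/
theorem triadExp_apply_two (t s : τ) (e : ι × ι × ι) (k : ι) :
    D t e (2, s, k) = if t = s ∧ e.2.2 = k then 1 else 0 := by
  simp [hD, Finsupp.single_apply]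

/-- Divisibility among triad monomials is equality: `m_{t'}(e') ∣ m_t(e) ↔ (t',e') = (t,e)`. -/
theorem triadExp_le_iff {t t' : τ} {e e' : ι × ι × ι} : D t' e' ≤ D t e ↔ t' = t ∧ e' = e := by
  constructor
  · intro h
    -- evaluate the inequality at the three variables of `m_{t'}(e')`
    have h0 := Finsupp.le_def.1 h (0, t', e'.1)
    have h1 := Finsupp.le_def.1 h (1, t', e'.2.1)
    have h2 := Finsupp.le_def.1 h (2, t', e'.2.2)
    simp only [triadExp_apply_zero hD, triadExp_apply_one hD, triadExp_apply_two hD, and_self,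
      if_true, one_le_ite_iff] at h0 h1 h2
    exact ⟨h0.1.symm, Prod.ext h0.2.symm (Prod.ext h1.2.symm h2.2.symm)⟩
  · rintro ⟨rfl, rfl⟩
    exact le_rfl

/-- The triad monomials dividing `m_t(f) · m_s(e)` (`t ≠ s`) are exactly `m_t(f)` and `m_s(e)`. -/
theorem triadExp_le_add_iff {t s t' : τ} (hts : t ≠ s) {f e e' : ι × ι × ι} :
    D t' e' ≤ D t f + D s e ↔ (t' = t ∧ e' = f) ∨ (t' = s ∧ e' = e) := by
  constructor
  · intro h
    -- evaluate the inequality at the three variables of `m_{t'}(e')`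
    have h0 := (Finsupp.le_def.1 h (0, t', e'.1)).trans_eq (Finsupp.add_apply _ _ _)
    have h1 := (Finsupp.le_def.1 h (1, t', e'.2.1)).trans_eq (Finsupp.add_apply _ _ _)
    have h2 := (Finsupp.le_def.1 h (2, t', e'.2.2)).trans_eq (Finsupp.add_apply _ _ _)
    simp only [triadExp_apply_zero hD, triadExp_apply_one hD, triadExp_apply_two hD, and_self,
      if_true, one_le_ite_add_ite_iff] at h0 h1 h2
    rcases h0 with ⟨rfl, h0⟩ | ⟨rfl, h0⟩
    · left
      rcases h1 with ⟨-, h1⟩ | ⟨h1, -⟩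
      · rcases h2 with ⟨-, h2⟩ | ⟨h2, -⟩
        · exact ⟨rfl, Prod.ext h0.symm (Prod.ext h1.symm h2.symm)⟩
        · exact absurd h2.symm hts
      · exact absurd h1.symm hts
    · right
      rcases h1 with ⟨h1, -⟩ | ⟨-, h1⟩
      · exact absurd h1 hts
      · rcases h2 with ⟨h2, -⟩ | ⟨-, h2⟩
        · exact absurd h2 hts
        · exact ⟨rfl, Prod.ext h0.symm (Prod.ext h1.symm h2.symm)⟩
  · rintro (⟨rfl, rfl⟩ | ⟨rfl, rfl⟩)
    · exact le_self_add
    · exact le_add_self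

/-- `if`-form of `triadExp_le_iff`. -/
theorem ite_triadExp_le {M : Type*} [Zero M] (t t' : τ) (e e' : ι × ι × ι) (x : M) :
    (if D t' e' ≤ D t e then x else 0) = if t' = t ∧ e' = e then x else 0 :=
  if_congr (triadExp_le_iff hD) rfl rfl

/-- `if`-form of `triadExp_le_add_iff`: the two cases are exclusive since `t ≠ s`. -/
theorem ite_triadExp_le_add {M : Type*} [AddZeroClass M] {t s : τ} (hts : t ≠ s) (t' : τ)
    (f e e' : ι × ι × ι) (x : M) :
    (if D t' e' ≤ D t f + D s e then x else 0) =
      (if t' = t ∧ e' = f then x else 0) + (if t' = s ∧ e' = e then x else 0) := by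
  rw [if_congr (triadExp_le_add_iff hD hts) rfl rfl]
  by_cases h1 : t' = t ∧ e' = f
  · have h2 : ¬ (t' = s ∧ e' = e) := fun h2 => hts (h1.1.symm.trans h2.1)
    rw [if_pos (Or.inl h1), if_pos h1, if_neg h2, add_zero]
  · by_cases h2 : t' = s ∧ e' = e
    · rw [if_pos (Or.inr h2), if_neg h1, if_pos h2, zero_add]
    · rw [if_neg (not_or.2 ⟨h1, h2⟩), if_neg h1, if_neg h2, add_zero]

/-! ## The coefficient identities and the contradiction -/

variable [Fintype ι] [Fintype τ] {K : Type*} [Field K] [CharZero K]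

/-- Core statement (bundled indices, arbitrary right-hand side): over a field of characteristic
zero, if the slot type has two distinct elements `s₀ ≠ s₁`, then no combination
`∑_e g_e · (∑_t m_t(e) - T_e)` with all `g_e` of total degree `≤ 5` equals `1`. -/
theorem sum_mul_brent_ne_one {s₀ s₁ : τ} (hs : s₀ ≠ s₁) (T : ι × ι × ι → K)
    (g : ι × ι × ι → MvPolynomial (Fin 3 × τ × ι) K) (hg : ∀ e, (g e).totalDegree ≤ 5) :
    (∑ e, g e * ((∑ t, monomial (D t e) 1) - C (T e))) ≠ 1 := by
  intro h
  -- abbreviations for the two families of coefficients we extract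
  obtain ⟨c, hc⟩ : ∃ c : ι × ι × ι → K, ∀ e, c e = coeff 0 (g e) := ⟨_, fun _ => rfl⟩
  obtain ⟨L, hL⟩ : ∃ L : τ → (ι × ι × ι) → (ι × ι × ι) → K,
      ∀ s e' e, L s e' e = coeff (D s e) (g e') := ⟨_, fun _ _ _ => rfl⟩
  -- (A) the constant coefficient
  have hA : ∑ e, c e * T e = -1 := by
    have h0 := congr_arg (coeff 0) h
    rw [coeff_sum_mul_brent, coeff_zero_one] at h0
    simp only [ite_triadExp_le_zero hD, Finset.sum_const_zero, zero_sub, Finset.sum_neg_distrib,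
      ← hc] at h0
    rw [← h0, neg_neg]
  -- (B) the coefficient of a triad monomial `m_s(e)`
  have hB : ∀ s e, c e = ∑ e', L s e' e * T e' := by
    intro s e
    have h3 := congr_arg (coeff (D s e)) h
    rw [coeff_sum_mul_brent, coeff_one, if_neg (triadExp_ne_zero hD s e).symm] at h3
    simp only [ite_triadExp_le hD, ite_and, Finset.sum_ite_eq', Finset.mem_univ, if_true,
      Finset.sum_sub_distrib, tsub_self, ← hc, ← hL] at h3
    exact sub_eq_zero.1 h3
  -- (C) the coefficient of `m_{s₁}(f) · m_{s₀}(e)`, a degree-6 monomial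
  have hC : ∀ f e, L s₀ f e + L s₁ e f = 0 := by
    intro f e
    have h6 := congr_arg (coeff (D s₁ f + D s₀ e)) h
    have hne : (0 : (Fin 3 × τ × ι) →₀ ℕ) ≠ D s₁ f + D s₀ e := fun h0 =>
      triadExp_ne_zero hD s₀ e (add_eq_zero.1 h0.symm).2
    rw [coeff_sum_mul_brent, coeff_one, if_neg hne] at h6
    simp only [ite_triadExp_le_add hD hs.symm, coeff_triadExp_add_triadExp hD _ _ _ _ (hg _),
      zero_mul, sub_zero, Finset.sum_add_distrib, ite_and, Finset.sum_ite_eq', Finset.mem_univ,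
      if_true, add_tsub_cancel_left, add_tsub_cancel_right, ← hL] at h6
    exact h6
  -- the contradiction: `S = ∑ c_e T_e` is both `-1` and equal to its own negative
  have key : ∑ e, c e * T e = -∑ e, c e * T e := by
    calc ∑ e, c e * T e = ∑ e, ∑ e', L s₀ e' e * T e' * T e := by
          simp_rw [hB s₀, Finset.sum_mul]
      _ = ∑ e, ∑ e', -(L s₁ e e' * T e * T e') := by
          refine Finset.sum_congr rfl fun e _ => Finset.sum_congr rfl fun e' _ => ?_
          rw [eq_neg_of_add_eq_zero_left (hC e' e)]
          ring
      _ = -∑ e', ∑ e, L s₁ e e' * T e * T e' := by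
          rw [Finset.sum_comm]
          simp only [Finset.sum_neg_distrib]
      _ = -∑ e', c e' * T e' := by
          simp_rw [hB s₁, Finset.sum_mul]
  rw [hA] at key
  norm_num at key

end TriadExp

/-- Curried form of `sum_mul_brent_ne_one`, in the literal shape of the route's Brent systems:
unknowns `X (0,t,i)`, `X (1,t,j)`, `X (2,t,k)`, equations indexed by `(i,j,k)`; any right-hand
side `T`, any field of characteristic zero, any slot type with two distinct slots. -/
theorem sum_mul_brent_ne_one' {ι τ K : Type*} [Fintype ι] [Fintype τ] [DecidableEq ι]
    [DecidableEq τ] [Field K] [CharZero K] {s₀ s₁ : τ} (hs : s₀ ≠ s₁) (T : ι → ι → ι → K)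
    (g : ι → ι → ι → MvPolynomial (Fin 3 × τ × ι) K) (hg : ∀ i j k, (g i j k).totalDegree ≤ 5) :
    (∑ i, ∑ j, ∑ k, g i j k * ((∑ t, X ((0 : Fin 3), t, i) * X ((1 : Fin 3), t, j) *
      X ((2 : Fin 3), t, k)) - C (T i j k))) ≠ 1 := by
  let D : τ → ι × ι × ι → (Fin 3 × τ × ι) →₀ ℕ := fun t e =>
    Finsupp.single ((0 : Fin 3), t, e.1) 1 + Finsupp.single ((1 : Fin 3), t, e.2.1) 1 +
      Finsupp.single ((2 : Fin 3), t, e.2.2) 1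
  have hD : ∀ t e, D t e = Finsupp.single ((0 : Fin 3), t, e.1) 1 +
      Finsupp.single ((1 : Fin 3), t, e.2.1) 1 + Finsupp.single ((2 : Fin 3), t, e.2.2) 1 :=
    fun _ _ => rfl
  have h := sum_mul_brent_ne_one hD hs (fun e => T e.1 e.2.1 e.2.2) (fun e => g e.1 e.2.1 e.2.2)
    fun e => hg _ _ _
  simpa only [Fintype.sum_prod_type, X_mul_X_mul_X_eq_monomial hD] using h

/-! ## The route item -/

open Literature.Computability.AlgebraicComplexity in
/-- **No linear-depth refutation** (route `BrentRefutationDepth`, item `NoLinearDepthRefutation`):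
for `r ≥ 3` and every `n`, the Brent system `B(n,r)` for `⟨n,n,n⟩` over `ℂ` has no Nullstellensatz
refutation whose multipliers all have total degree `≤ 5`; i.e. `D_NS(n,r) ≥ 6`. -/
theorem noLinearDepthRefutation_proof :
    Summit.MatrixMultiplication.MatrixMultiplication.Theses.BrentRefutationDepth.NoLinearDepthRefutation := by
  unfold Summit.MatrixMultiplication.MatrixMultiplication.Theses.BrentRefutationDepth.NoLinearDepthRefutation
  rintro n r hr ⟨g, hg, h⟩
  have hs : (⟨0, by omega⟩ : Fin r) ≠ ⟨1, by omega⟩ := by simp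
  exact sum_mul_brent_ne_one' hs (matMulTensor ℂ n n n) g hg h

end Summit.MatrixMultiplication.MatrixMultiplication.Theorems
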